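/-
Copyright (c) 2026. All rights reserved.
Released under Apache 2.0 license as described in the file LICENSE.
Authors: HodgeCM publication cell (pub-hodgecm), model-construction sub-cell, discharge seat `mc-discharge-2`.
-/
import Literature.NumberTheory.GelbartRogawski1991.UnitaryDualPairSeesawSchemeSmall
import Literature.NumberTheory.Weil1964.AdelicThetaMajorants
import HarnessLib

-- buildfix G11b-3 recipe (LEDGER B13-1/B13-3): elaborate sequentially so the trailing `attribute [implicit_reducible]`
-- block (reducibilityCoreExt is keyed to the async environment branch) is in force at `.olean` export.
set_option Elab.async false

/-!
# Weil majorants in the `pairSmall` currency: transport of theta majorants under re-indexing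

Topic `NumberTheory/GelbartRogawski1991`; namespace `Literature.NumberTheory.GelbartRogawski1991.UnitaryDualPair`.
KERNEL ONLY (0 definitions, 0 records, 0 named facts).  The small-pair representations of the see-saw schemes of
`UnitaryDualPairSeesawSchemeSmall` are read on `𝒮(𝔸_F^{N × M_j})` through `pairSmall_j s_j = R_{e_j}⁻¹ ∘ pairSplitting s_j`
(`e_j : Fin N × Fin M_j ≃ Fin n_j`), whereas Weil's majorants for a dual pair are PRODUCED in the `pairRep` currency on
`𝒮(𝔸_F^{n_j})` (`Weil1964.hasThetaMajorants_omega_pairSplitting`, `…_cmPairSplitting…` of `ArchDualPairThetaMajorants`).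
This file is the bridge:

* §0 (namespace `Literature.NumberTheory.Weil1964`) **`HasThetaMajorants.reindexConj`** — theta majorants are transported
  by re-indexing: if `g ↦ ρ(g)` has theta majorants on `𝒮(𝔸_F^ι)` then so has `g ↦ R_e ∘ ρ(g) ∘ R_e⁻¹` on `𝒮(𝔸_F^{ι′})`
  (the terms are the same numbers, `(R_e Φ)(ξ′) = Φ(ξ′ ∘ e)`, and the majorant `ξ′ ↦ u(ξ′ ∘ e)` is summable with `u`);
* §1 **`omega_pairSmall₁_apply`** / **`omega_pairSmall₂_apply`** — `ω(pairSmall_j s_j p) Φ = R_{e_j}⁻¹ (ω_ψ(s_pair p) (R_{e_j} Φ))`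
  (`adelicMpCont.omega_reindex_apply`), and **`hasThetaMajorants_omega_pairSmall₁`** / **`…₂`**: Weil majorants for
  `ω_ψ ∘ s_pair` (`pairRep s_j`, the hypothesis `hρ` of `thetaKernelDatumOfCompatibleSplitting` / `cmThetaKernelDatum`)
  give Weil majorants for `ω ∘ pairSmall_j s_j` — EXACTLY the hypotheses `hρ₁`, `hρ₂` of the `(12)` dischargers
  `hasThetaMajorants_seesawRep₁/₂` (`UnitaryDualPairSeesawThetaPeriod`), of the `(34)` dischargers
  `hasThetaMajorants_seesawConjRep₁/₂` / `continuous_charV₃₄` (`UnitaryDualPairSeesawConjMajorants`) and of the deep-level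
  fixing theorems of `UnitaryDualPairSeesawConjDeepLevelFixed` / `…CMLinesDeepLevelFixed` / `…CMLinesConjDeepLevelFixed`.

Nothing here is a claim of the manuscripts under adjudication: kernel analysis over the tree's constructed objects.

References (provenance): A. Weil, Acta Math. 111 (1964), Chap. III n° 41, Lemme 5 p. 192 / Thm 6 p. 193; S. Gelbart,
J. Rogawski, Invent. Math. 105 (1991), §3.1 p. 454 (the Weil representation re-indexed along `V ⊗ W ≅ F^n`).
-/

set_option autoImplicit false

noncomputable section

open scoped Matrix Kronecker
open NumberField
open Literature.NumberTheory.Automorphic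
open Literature.NumberTheory.Automorphic.UnitaryGroup
open Literature.NumberTheory.Weil1964

namespace Literature.NumberTheory.Weil1964

/-! ## §0. Theta majorants under re-indexing -/

section ReindexMajorants

variable {F : Type} [Field F] [NumberField F] {ι ι' : Type} [Fintype ι] [Fintype ι']
  {G : Type*} [TopologicalSpace G]

/-- **Theta majorants are transported by re-indexing**: if `g ↦ ρ(g)` has theta majorants on `𝒮(𝔸_F^ι)`, then
`g ↦ R_e ∘ ρ(g) ∘ R_e⁻¹` has theta majorants on `𝒮(𝔸_F^{ι′})` — the terms are the same numbers
(`(R_e Φ)(ξ′) = Φ(ξ′ ∘ e)` at principal points) and `ξ′ ↦ u(ξ′ ∘ e)` is summable with `u`.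
[cite: Weil1964, Chap. III n° 41, Lemme 5 p. 192] -/
theorem HasThetaMajorants.reindexConj (e : ι ≃ ι') {ρ : G → piSchwartzBruhat F ι → piSchwartzBruhat F ι}
    (h : HasThetaMajorants ρ) :
    HasThetaMajorants fun g (Ψ : piSchwartzBruhat F ι') => piSBReindex F e (ρ g ((piSBReindex F e).symm Ψ)) := by
  refine ⟨fun Ψ ξ' => ?_, fun Ψ g₀ => ?_⟩
  · exact (h.continuous_eval ((piSBReindex F e).symm Ψ) (ξ' ∘ e)).congr fun g => rfl
  · obtain ⟨V, hV, u, hu, hle⟩ := h.exists_majorant ((piSBReindex F e).symm Ψ) g₀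
    have hinj : Function.Injective fun ξ' : ι' → F => ξ' ∘ e := by
      intro ξ₁ ξ₂ hξ
      funext i'
      simpa only [Function.comp_apply, Equiv.apply_symm_apply] using congrFun hξ (e.symm i')
    exact ⟨V, hV, fun ξ' => u (ξ' ∘ e), hu.comp_injective hinj, fun ξ' g hg => hle (ξ' ∘ e) g hg⟩

end ReindexMajorants

end Literature.NumberTheory.Weil1964

namespace Literature.NumberTheory.GelbartRogawski1991

namespace UnitaryDualPair

/-! ## §1. `ω ∘ pairSmall_j s_j` in terms of `ω_ψ ∘ s_pair`, and its Weil majorants -/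

section Small

variable (F E : Type) [Field F] [NumberField F] [Field E] [NumberField E] [Algebra F E]
variable (c : E ≃ₐ[F] E) (N M₁ M₂ : ℕ) {n₁ n₂ : ℕ} (e₁ : Fin N × Fin M₁ ≃ Fin n₁) (e₂ : Fin N × Fin M₂ ≃ Fin n₂)
variable (JV : Matrix (Fin N) (Fin N) E) (J₁ : Matrix (Fin M₁) (Fin M₁) E) (J₂ : Matrix (Fin M₂) (Fin M₂) E)
variable {TV : Matrix (Fin N) (Fin N) F} {T₁ : Matrix (Fin M₁) (Fin M₁) F} {T₂ : Matrix (Fin M₂) (Fin M₂) F}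

/-- **`ω(pairSmall₁ s₁ p) Φ = R_{e₁}⁻¹ (ω_ψ(s_pair p) (R_{e₁} Φ))`** (`pairSmall₁ s₁ = R_{e₁}⁻¹ ∘ pairSplitting s₁` and
`ω(reindex p) = R_e ∘ ω(p) ∘ R_e⁻¹`). [cite: GelbartRogawski1991, §3.1 p. 454] -/
theorem omega_pairSmall₁_apply (s₁ : adelicPair F E c N M₁ JV J₁ →* adelicMpCont F (Fin n₁) (adelicGram F e₁ TV T₁))
    (p : adelic F E c N JV × adelic F E c M₁ J₁) (Φ : piSchwartzBruhat F (Fin N × Fin M₁)) :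
    adelicMpCont.omega F (Fin N × Fin M₁)
        (TV.map (algebraMap F (AdeleRing (𝓞 F) F)) ⊗ₖ T₁.map (algebraMap F (AdeleRing (𝓞 F) F)))
        (pairSmall₁ F E c N M₁ e₁ JV J₁ s₁ p) Φ =
      (piSBReindex F e₁).symm (pairRep F E c N M₁ e₁ JV J₁ s₁ p (piSBReindex F e₁ Φ)) :=
  adelicMpCont.omega_reindex_symm_apply F e₁ _ (pairSplitting F E c N M₁ e₁ JV J₁ s₁ p) Φ

/-- **`ω(pairSmall₂ s₂ p) Φ = R_{e₂}⁻¹ (ω_ψ(s_pair p) (R_{e₂} Φ))`.** [cite: GelbartRogawski1991, §3.1 p. 454] -/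
theorem omega_pairSmall₂_apply (s₂ : adelicPair F E c N M₂ JV J₂ →* adelicMpCont F (Fin n₂) (adelicGram F e₂ TV T₂))
    (p : adelic F E c N JV × adelic F E c M₂ J₂) (Φ : piSchwartzBruhat F (Fin N × Fin M₂)) :
    adelicMpCont.omega F (Fin N × Fin M₂)
        (TV.map (algebraMap F (AdeleRing (𝓞 F) F)) ⊗ₖ T₂.map (algebraMap F (AdeleRing (𝓞 F) F)))
        (pairSmall₂ F E c N M₂ e₂ JV J₂ s₂ p) Φ =
      (piSBReindex F e₂).symm (pairRep F E c N M₂ e₂ JV J₂ s₂ p (piSBReindex F e₂ Φ)) :=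
  adelicMpCont.omega_reindex_symm_apply F e₂ _ (pairSplitting F E c N M₂ e₂ JV J₂ s₂ p) Φ

/-- **Weil majorants for `ω ∘ pairSmall₁ s₁` from Weil majorants for `ω_ψ ∘ s_pair`** (the hypothesis `hρ₁` of the
`(12)`/`(34)` see-saw dischargers and deep-level fixing theorems, from the hypothesis `hρ` of the small pair's
`thetaKernelDatumOfCompatibleSplitting`): transport under `R_{e₁}⁻¹`. [cite: Weil1964, Chap. III n° 41, Lemme 5 p. 192] -/
theorem hasThetaMajorants_omega_pairSmall₁
    {s₁ : adelicPair F E c N M₁ JV J₁ →* adelicMpCont F (Fin n₁) (adelicGram F e₁ TV T₁)}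
    (hρ : HasThetaMajorants fun (p : adelic F E c N JV × adelic F E c M₁ J₁) (Φ : piSchwartzBruhat F (Fin n₁)) =>
      pairRep F E c N M₁ e₁ JV J₁ s₁ p Φ) :
    HasThetaMajorants fun (p : adelic F E c N JV × adelic F E c M₁ J₁) (Φ : piSchwartzBruhat F (Fin N × Fin M₁)) =>
      adelicMpCont.omega F (Fin N × Fin M₁)
        (TV.map (algebraMap F (AdeleRing (𝓞 F) F)) ⊗ₖ T₁.map (algebraMap F (AdeleRing (𝓞 F) F)))
        (pairSmall₁ F E c N M₁ e₁ JV J₁ s₁ p) Φ := by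
  have hfun : (fun (p : adelic F E c N JV × adelic F E c M₁ J₁) (Φ : piSchwartzBruhat F (Fin N × Fin M₁)) =>
      adelicMpCont.omega F (Fin N × Fin M₁)
        (TV.map (algebraMap F (AdeleRing (𝓞 F) F)) ⊗ₖ T₁.map (algebraMap F (AdeleRing (𝓞 F) F)))
        (pairSmall₁ F E c N M₁ e₁ JV J₁ s₁ p) Φ) =
      fun p Φ => piSBReindex F e₁.symm (pairRep F E c N M₁ e₁ JV J₁ s₁ p ((piSBReindex F e₁.symm).symm Φ)) := by
    funext p Φ
    simp only [omega_pairSmall₁_apply, piSBReindex_symm, Equiv.symm_symm]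
  rw [hfun]
  exact hρ.reindexConj e₁.symm

/-- **Weil majorants for `ω ∘ pairSmall₂ s₂` from Weil majorants for `ω_ψ ∘ s_pair`** (hypothesis `hρ₂` of the see-saw
dischargers). [cite: Weil1964, Chap. III n° 41, Lemme 5 p. 192] -/
theorem hasThetaMajorants_omega_pairSmall₂
    {s₂ : adelicPair F E c N M₂ JV J₂ →* adelicMpCont F (Fin n₂) (adelicGram F e₂ TV T₂)}
    (hρ : HasThetaMajorants fun (p : adelic F E c N JV × adelic F E c M₂ J₂) (Φ : piSchwartzBruhat F (Fin n₂)) =>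
      pairRep F E c N M₂ e₂ JV J₂ s₂ p Φ) :
    HasThetaMajorants fun (p : adelic F E c N JV × adelic F E c M₂ J₂) (Φ : piSchwartzBruhat F (Fin N × Fin M₂)) =>
      adelicMpCont.omega F (Fin N × Fin M₂)
        (TV.map (algebraMap F (AdeleRing (𝓞 F) F)) ⊗ₖ T₂.map (algebraMap F (AdeleRing (𝓞 F) F)))
        (pairSmall₂ F E c N M₂ e₂ JV J₂ s₂ p) Φ := by
  have hfun : (fun (p : adelic F E c N JV × adelic F E c M₂ J₂) (Φ : piSchwartzBruhat F (Fin N × Fin M₂)) =>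
      adelicMpCont.omega F (Fin N × Fin M₂)
        (TV.map (algebraMap F (AdeleRing (𝓞 F) F)) ⊗ₖ T₂.map (algebraMap F (AdeleRing (𝓞 F) F)))
        (pairSmall₂ F E c N M₂ e₂ JV J₂ s₂ p) Φ) =
      fun p Φ => piSBReindex F e₂.symm (pairRep F E c N M₂ e₂ JV J₂ s₂ p ((piSBReindex F e₂.symm).symm Φ)) := by
    funext p Φ
    simp only [omega_pairSmall₂_apply, piSBReindex_symm, Equiv.symm_symm]
  rw [hfun]
  exact hρ.reindexConj e₂.symm

end Small

/-! ### Build-lane note (ops-buildfix G11b-3 recipe, LEDGER B13-1, 2026-08-21)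
`lean -o` (the hub build lane, never `lean`/the gate check) runs Lean 4.32's library-suggestion indexers
(`Lean.LibrarySuggestions.SymbolFrequency` / `SineQuaNon`, from their `exportEntriesFn`) over the statement of
every local theorem that is not a denied premise; on this family's statements (very large dependent binder
telescopes through the theta-kernel / dual-pair data) that fold runs for tens of minutes to hours and the build
lane kills the job (incident G11b-3, run/shared/lean/ops/buildfix/G11b-3-DOSSIER.md). `isDeniedPremise` skips
`[implicit_reducible]` constants before any fold, and a reducibility status on a *theorem* is inert (Meta never
unfolds `thmInfo`; the kernel ignores the attribute), so the public theorems of this file are tagged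
`[implicit_reducible]` purely to keep them out of that index. Only other effect: they are not offered by
`+suggestions` premise selectors. No statement or proof is changed; superseded if the operator lands a
deny-list form (`HarnessLib.PremiseIndex`). -/
set_option allowUnsafeReducibility true in
attribute [implicit_reducible]
  _root_.Literature.NumberTheory.Weil1964.HasThetaMajorants.reindexConj omega_pairSmall₁_apply
  omega_pairSmall₂_apply hasThetaMajorants_omega_pairSmall₁ hasThetaMajorants_omega_pairSmall₂

end UnitaryDualPair

end Literature.NumberTheory.GelbartRogawski1991

end
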